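import Summits.ResolutionOfSingularities.ResolutionOfSingularities.Theorems.FrobeniusLadderFRationalModificationPowerLift
import Summits.ResolutionOfSingularities.ResolutionOfSingularities.Theorems.FrobeniusLadderFRationalModificationExchange
import Summits.ResolutionOfSingularities.ResolutionOfSingularities.Theorems.FrobeniusLadderFRationalModificationAdaptedGenerators
import Summits.ResolutionOfSingularities.ResolutionOfSingularities.Theorems.FrobeniusLadderFRationalModificationSopWeaklyRegular
import Summits.ResolutionOfSingularities.ResolutionOfSingularities.Theorems.FrobeniusLadderFRationalModificationDivisorCertificate
import Summits.ResolutionOfSingularities.ResolutionOfSingularities.Theorems.FrobeniusLadderFRationalModificationDeformFWPointwise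
import Summits.ResolutionOfSingularities.ResolutionOfSingularities.Theorems.FrobeniusLadderFRationalModificationTestExponent
import Summits.ResolutionOfSingularities.ResolutionOfSingularities.Theorems.FrobeniusLadderFRationalModificationIntegralModel
import HarnessLib

/-!
# The ring certificate makes a local domain F-rational — over ANY ground field
(crux `FrobeniusLadder.FRationalModification`, line `Sketch` v8, consumer chain)

Crux `stmt-ResolutionOfSingularities-15316` (`FrobeniusLadder.FRationalModification`: a Cohen–Macaulay
F-injective proper birational model ⇒ an F-rational proper birational model). The (D+)/Cartier-hull
frame of the crux folder needs, at a stalk `S = 𝒪_{W,w}` on the hull, the inversion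
"`t ∈ 𝔪 ∖ 0`, `S[1/t]` regular, `S/(t)` Cohen–Macaulay F-injective ⇒ `S` F-rational". Cycle 4 proved it
for F-FINITE `S` (`CartierCertificateHolds.isFRational_of_divisorCertificate_of_isRegularRing_away`,
via Hochster–Huneke 1989 Thm 3.4 = a UNIFORM parameter test exponent). This file proves it for local
domains `S` that are NOT F-finite but admit, through every finite subset, a faithfully flat Noetherian
F-finite submodel `S₀ → S` (hypothesis `hmod`; stalks of schemes of finite type over ANY field have
them — stub `stub_stalkSubmodels`, EGA IV₃ §8):

* `testExponent_FW` — the POINTWISE test exponent in the Fedder–Watanabe shape: for the parameter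
  ideal `(f, s)`, `y`, and a witness `c ≠ 0` of `y ∈ (f, s)^*`, ONE `n` with
  `fⁿ y^q ∈ (f^q, s₁^q, …, s_d^q)` for all `q` (from the landed `TestExponent.stub_testExponent`:
  descent of regularity of `S₀[1/f]` and of the memberships, Hochster–Huneke on `S₀`);
* `isFRational_of_FW_pointwise` — Fedder–Watanabe data + pointwise exponents ⇒ F-rational (the
  landed chain `AdaptedGenerators` → `DeformFWPointwise` → `PowerLift` → `Exchange`, as in
  `IntegralModel.isFRational_of_FW` but with `DeformFWPointwise.stub_deformFWPointwise`);
* `isFRational_of_ringCertificate` — the inversion itself (`DivisorCertificate.stub_divisorCertificate`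
  for Cohen–Macaulayness and the F-injectivity data upstairs, then the above).

Everything is proved; no named facts; no F-finiteness hypothesis.

## References

* R. Fedder, K.-i. Watanabe, *A characterization of F-regularity in terms of F-purity*, in:
  Commutative Algebra (Berkeley 1987), MSRI Publ. 15, Springer 1989, Prop. 2.13. [FedderWatanabe1989]
* M. Hochster, C. Huneke, *Tight closure and strong F-regularity*, Mém. SMF 38 (1989), Thm. 3.4.
  [HochsterHuneke1989]
* A. Grothendieck, J. Dieudonné, EGA IV₃ (1966), §8 (models over subfields of finite type). [EGAIV3]
-/

-- single-problem summit: the doubled namespace component `ResolutionOfSingularities` is forced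
set_option linter.dupNamespace false

noncomputable section

open IsLocalRing RingTheory.Sequence
open Literature.RingTheory.TightClosure Literature.AlgebraicGeometry.Resolution
open Summit.ResolutionOfSingularities.ResolutionOfSingularities.Theorems.FRationalModification

namespace Summit.ResolutionOfSingularities.ResolutionOfSingularities.Theorems.FRationalModification.RingCertificate

/-- **Pointwise test exponent, Fedder–Watanabe shape.** `S` a domain of characteristic `p` with
faithfully flat Noetherian F-finite submodels through every finite subset, `f ≠ 0` with `S[1/f]`
regular, `(f, s)` any finite family, `y` and `c ≠ 0` with `c · y^(p^e) ∈ (f, s)^[p^e]` for all `e`: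
then for ONE `n`, `fⁿ · y^(p^e) ∈ (f^(p^e), s₁^(p^e), …, s_d^(p^e))` for ALL `e`
(`TestExponent.stub_testExponent` applied to the family `Fin.cons f s` with constant exponent vector
`p^e` and `b = p^e`, using `((f, s)^[p^e])^[p^e'] = (f, s)^[p^(e+e')]`).
[cite: HochsterHuneke1989, Thm. 3.4] -/
theorem testExponent_FW (p : ℕ) [Fact p.Prime] {S : Type} [CommRing S] [IsDomain S] [CharP S p]
    (hmod : ∀ F : Finset S, ∃ (S₀ : Type) (_ : CommRing S₀) (_ : Algebra S₀ S),
      IsNoetherianRing S₀ ∧ IsFFinite p 1 S₀ ∧ Module.FaithfullyFlat S₀ S ∧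
        (↑F : Set S) ⊆ Set.range (algebraMap S₀ S))
    {f : S} (hf0 : f ≠ 0) (hreg : IsRegularRing (Localization.Away f)) {d : ℕ} (s : Fin d → S)
    (y c : S) (hc : c ≠ 0)
    (hcy : ∀ e : ℕ, c * y ^ p ^ e ∈ frobeniusPower (p ^ e) (Ideal.span (insert f (Set.range s)))) :
    ∃ n : ℕ, ∀ e : ℕ, f ^ n * y ^ p ^ e ∈
      Ideal.span (insert (f ^ p ^ e) (Set.range fun i => s i ^ p ^ e)) := by
  obtain ⟨n, hn⟩ := TestExponent.stub_testExponent p hmod hf0 hreg (Fin.cons f s) y c hc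
  refine ⟨n, fun e => ?_⟩
  have hrange : (Set.range fun i => (Fin.cons f s : Fin (d + 1) → S) i ^ p ^ e) =
      insert (f ^ p ^ e) (Set.range fun i => s i ^ p ^ e) := by
    have : (fun i => (Fin.cons f s : Fin (d + 1) → S) i ^ p ^ e) =
        Fin.cons (f ^ p ^ e) (fun i => s i ^ p ^ e) := by
      ext i
      refine Fin.cases ?_ (fun j => ?_) i <;> simp
    rw [this, Fin.range_cons]
  have h := hn (fun _ => p ^ e) (p ^ e) (fun e' => ?_)
  · rwa [hrange] at h
  · rw [hrange, ← pow_mul, ← pow_add]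
    have hins : Ideal.span (insert (f ^ p ^ e) (Set.range fun i => s i ^ p ^ e)) =
        frobeniusPower (p ^ e) (Ideal.span (insert f (Set.range s))) := by
      rw [frobeniusPower_span, Set.image_insert_eq, ← Set.range_comp]
      rfl
    rw [hins, frobeniusPower_frobeniusPower]
    exact hcy (e + e')

/-- Raising the distinguished generator of `(g, u)` to a positive power does not change the radical
(`DeformFW.radical_span_insert_pow` with the other generators untouched). [folklore] -/
theorem radical_span_insert_pow_eq {S : Type*} [CommRing S] {d : ℕ} (g : S) (u : Fin d → S) {a : ℕ}
    (ha : 0 < a) :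
    (Ideal.span (insert (g ^ a) (Set.range u))).radical =
      (Ideal.span (insert g (Set.range u))).radical := by
  have h := DeformFW.radical_span_insert_pow g u ha Nat.one_pos
  simpa only [pow_one] using h

/-- **Fedder–Watanabe data with pointwise test exponents ⇒ F-rational.** `S` a Noetherian local domain
of characteristic `p` with faithfully flat Noetherian F-finite submodels through every finite subset,
Cohen–Macaulay (every system of parameters weakly regular), `dim S = d + 1`, `g ∈ 𝔪 ∖ 0` with `S[1/g]`
regular and `S/gS` F-injective upstairs at every completion of `g` to a system of parameters
(`y^q ∈ (g) + (s)^[q] ⇒ y ∈ (g, s)`). Then every parameter ideal of `S` is tightly closed: regenerate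
`(t) = (b, u)` with `(g, u)` a parameter ideal (`AdaptedGenerators`), `(g, u)` is tightly closed by
Fedder–Watanabe with the pointwise exponents of `testExponent_FW` (`DeformFWPointwise`), lift to
`(gᴺ, u)` with `gᴺ ∈ (t)` (`PowerLift`) and exchange `gᴺ` for `b` (`Exchange`).
[cite: FedderWatanabe1989, Prop. 2.13] -/
theorem isFRational_of_FW_pointwise (p : ℕ) [Fact p.Prime] {S : Type} [CommRing S] [IsLocalRing S]
    [IsNoetherianRing S] [IsDomain S] [CharP S p]
    (hmod : ∀ F : Finset S, ∃ (S₀ : Type) (_ : CommRing S₀) (_ : Algebra S₀ S),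
      IsNoetherianRing S₀ ∧ IsFFinite p 1 S₀ ∧ Module.FaithfullyFlat S₀ S ∧
        (↑F : Set S) ⊆ Set.range (algebraMap S₀ S))
    (hCM : ∀ ⦃n : ℕ⦄ (s : Fin n → S), IsSystemOfParameters s → IsWeaklyRegular S (List.ofFn s))
    {d : ℕ} {g : S} (hd : ringKrullDim S = ((d + 1 : ℕ) : WithBot ℕ∞))
    (hgm : g ∈ maximalIdeal S) (hg0 : g ≠ 0) (hreg : IsRegularRing (Localization.Away g))
    (hFinj : ∀ s : Fin d → S, (Ideal.span (insert g (Set.range s))).radical = maximalIdeal S →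
      ∀ (y : S) (e : ℕ), y ^ p ^ e ∈
        Ideal.span {g} ⊔ frobeniusPower (p ^ e) (Ideal.span (Set.range s)) →
        y ∈ Ideal.span (insert g (Set.range s))) :
    IsFRational S p := by
  intro n t ht
  obtain ⟨hdim, hrad⟩ := ht
  -- `n = d + 1`
  have hn : n = d + 1 := by
    have h := hdim.symm.trans hd
    exact_mod_cast h
  subst hn
  -- regenerate `(t) = (b, u)` with `(g, u)` a parameter ideal
  obtain ⟨b, u, htu, hgu⟩ := AdaptedGenerators.stub_adaptedGenerators hd hgm hg0 t hrad
  -- `(g, u)` is tightly closed (FW 2.13, pointwise test exponents)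
  have hgu_tc : IsTightlyClosed p (Ideal.span (insert g (Set.range u))) :=
    DeformFWPointwise.stub_deformFWPointwise p hCM hd hgu (hFinj u hgu)
      (fun y c hc hcy => testExponent_FW p hmod hg0 hreg u y c hc hcy)
  -- cofinality: `g^(N+1) ∈ 𝔪^(N+1) ⊆ (t) = (b, u)`
  obtain ⟨N, hN⟩ := Ideal.exists_pow_le_of_le_radical_of_fg hrad.ge
    (IsNoetherian.noetherian (maximalIdeal S))
  have hgN : g ^ (N + 1) ∈ Ideal.span (insert b (Set.range u)) := by
    rw [← htu]
    exact ((Ideal.pow_le_pow_right (Nat.le_succ N)).trans hN) (Ideal.pow_mem_pow hgm _)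
  -- lift the power of `g`, then exchange `g^(N+1)` for `b`
  have hgNu_tc : IsTightlyClosed p (Ideal.span (insert (g ^ (N + 1)) (Set.range u))) :=
    PowerLift.stub_powerLift p hCM hd hgu hgu_tc (Nat.succ_pos N)
  have hgNu_rad : (Ideal.span (insert (g ^ (N + 1)) (Set.range u))).radical = maximalIdeal S := by
    rw [radical_span_insert_pow_eq g u (Nat.succ_pos N), hgu]
  rw [htu]
  exact Exchange.stub_exchange p hCM hd hgNu_rad hgN hgNu_tc

/-- **The ring certificate makes a local domain with F-finite submodels F-rational — no F-finiteness
of the ring itself.** `S` a Noetherian local domain of characteristic `p` admitting, through every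
finite subset, a faithfully flat Noetherian F-finite submodel (`hmod`); `t ∈ 𝔪_S`, `t ≠ 0`, with
`S[1/t]` a regular ring and `S/(t)` Cohen–Macaulay and F-injective (every system of parameters of
`S/(t)` a weakly regular sequence generating a Frobenius-closed ideal). Then `S` is F-rational
(`DivisorCertificate.stub_divisorCertificate` gives Cohen–Macaulayness of `S` and the F-injectivity
data upstairs; `isFRational_of_FW_pointwise` concludes). The F-finite special case is cycle 4's
`CartierCertificateHolds.isFRational_of_divisorCertificate_of_isRegularRing_away`.
[cite: FedderWatanabe1989, Prop. 2.13; HochsterHuneke1989, Thm. 3.4] -/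
theorem isFRational_of_ringCertificate (p : ℕ) [Fact p.Prime] {S : Type} [CommRing S]
    [IsLocalRing S] [IsNoetherianRing S] [IsDomain S] [CharP S p]
    (hmod : ∀ F : Finset S, ∃ (S₀ : Type) (_ : CommRing S₀) (_ : Algebra S₀ S),
      IsNoetherianRing S₀ ∧ IsFFinite p 1 S₀ ∧ Module.FaithfullyFlat S₀ S ∧
        (↑F : Set S) ⊆ Set.range (algebraMap S₀ S))
    {t : S} (htm : t ∈ maximalIdeal S) (ht0 : t ≠ 0) (hreg : IsRegularRing (Localization.Away t))
    (hD : ∀ d : ℕ, ringKrullDim (S ⧸ Ideal.span {t}) = d → ∀ u : Fin d → S ⧸ Ideal.span {t},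
      (Ideal.span (Set.range u)).radical.IsMaximal →
        RingTheory.Sequence.IsWeaklyRegular (S ⧸ Ideal.span {t}) (List.ofFn u) ∧
        ∀ y : S ⧸ Ideal.span {t}, (∃ e : ℕ, y ^ p ^ e ∈
          Ideal.span ((fun z : S ⧸ Ideal.span {t} => z ^ p ^ e) ''
            (Ideal.span (Set.range u) : Set (S ⧸ Ideal.span {t})))) →
          y ∈ Ideal.span (Set.range u)) :
    IsFRational S p := by
  obtain ⟨hCM, d, hd, hFinj⟩ := DivisorCertificate.stub_divisorCertificate p htm ht0 hD
  exact isFRational_of_FW_pointwise p hmod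
    (fun n s hs => SopWeaklyRegular.stub_sopWeaklyRegular hCM s hs) hd htm ht0 hreg hFinj

end Summit.ResolutionOfSingularities.ResolutionOfSingularities.Theorems.FRationalModification.RingCertificate

end
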